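import Summits.CriticalPhenomena.PercolationContinuityZ3.Theorems.PercNearOneGluingNoHeavyLowerTailOneCutFiveZeroOnePocket
import HarnessLib

/-!
# `NoHeavyLowerTail` (stmt-CriticalPhenomena-4575) — the glued half of oneCut(5) from the pocket exchange with THRESHOLD ½
# ("T3w": `μ(o↔a) ≥ ½` in place of `Σ_v μ(o↔v) > 2`)

Support file (prover seat `prim-a5-assembly-2`, gen 2; `--supports stmt-CriticalPhenomena-4575`; memo
`run/shared/lean/prim/prim-a5/ASSEMBLY.md` §10, INEQ-CLAIMS A5-Z32F).  No definitions, no named facts, no sorries.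

`μ = prodBernoulli w` on `Fin n`, observer `o`, vertices `a, b, c`, `q_v = μ(o ↔ v)`, pocket `B = C_o ∩ {a,b,c}`.  The row
`Z(3,2)` ⟺ (POCKET, threshold `Σ q > 2`) (`…OneCutFiveZeroOnePocket`).  A second, INCOMPARABLE threshold is census-clean and
analytically sharp on the interpolating family (ASSEMBLY §10 (a), A5-Z32F (iii)):

  (POCKET-½)  `o, a, b, c` distinct, `q_a ≥ ½`, `q_a ≤ q_b`, `q_a ≤ q_c`  ⟹  `μ(B = {a}) ≤ μ(B = {b,c})`.

It ALSO yields the glued half of the `|A| = 5` rung: for `o ∈ A`, `A.card = 5`, `E N > 4`, the four other relays have `Σ q > 3`, so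
after dropping the weakest of them the remaining three all have `q ≥ ½` (two relays below `½` would force `Σ ≤ 3`), and the exchange
at the weakest of those three bounds `μ{#T_o ≤ 2} ≤ μ{o reaches ≤ 1 of the three} ≤ μ(o ↮ a) ≤ t`.

* `OneCutFive.measureReal_le_one_le_compl_of_exchange` — the exchange step: `μ(B={a}) ≤ μ(B={b,c})` ⟹ `μ{≤ 1 of R reached} ≤ μ(o ↮ a)`
  for any `R ∋ a, b, c`.
* `OneCutFive.twoFinger_at_observer_of_pocketHalf`, `OneCutFive.oneCut5_at_of_mem_of_pocketHalf` — (POCKET-½) for all graphs ⟹ the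
  two-finger bound at a relay observer and the `o ∈ A` half of `OneCutFive.OneCut5`.
HONEST LABEL: toward `|A| = 5` of the one-arm near-critical percolation programme (crux 4575); (POCKET-½) is OPEN (census-clean,
no row certificate known); nothing here asserts it.
-/

noncomputable section

namespace Summit.CriticalPhenomena.PercolationContinuityZ3.Theorems

open MeasureTheory Set Literature.Probability.LatticeModels Literature.Probability.Percolation
open scoped Classical BigOperators

namespace OneCutFive

variable {n : ℕ}

/-- **The exchange step.**  If `μ(B = {a}) ≤ μ(B = {b,c})` for distinct `a, b, c ∈ R`, then
`μ{o reaches ≤ 1 vertex of R} ≤ μ(o ↮ a)`: `{≤ 1} ⊆ {B={a}} ∪ ({≤ 1} ∩ {o↮a})`, and `{B={b,c}} ⊆ {o↮a}` is disjoint from `{≤ 1}`.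
[this work] -/
theorem measureReal_le_one_le_compl_of_exchange (w : Sym2 (Fin n) → unitInterval) (R : Finset (Fin n)) (o a b c : Fin n)
    (ha : a ∈ R) (hb : b ∈ R) (hc : c ∈ R) (hab : a ≠ b) (hac : a ≠ c) (hbc : b ≠ c)
    (hP : (prodBernoulli w).real {ω : BondConfig (Fin n) | ω ∈ openConn o a ∧ ω ∉ openConn o b ∧ ω ∉ openConn o c} ≤
      (prodBernoulli w).real {ω : BondConfig (Fin n) | ω ∉ openConn o a ∧ ω ∈ openConn o b ∧ ω ∈ openConn o c}) :
    (prodBernoulli w).real {ω : BondConfig (Fin n) | (R.filter fun v => ω ∈ openConn o v).card ≤ 1} ≤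
      (prodBernoulli w).real (openConn o a : Set (BondConfig (Fin n)))ᶜ := by
  set μ := prodBernoulli w with hμ
  have hmeas : ∀ s : Set (BondConfig (Fin n)), MeasurableSet s := fun _ => MeasurableSet.of_discrete
  set L : Set (BondConfig (Fin n)) := {ω | (R.filter fun v => ω ∈ openConn o v).card ≤ 1} with hL
  set E₁ : Set (BondConfig (Fin n)) := {ω | ω ∈ openConn o a ∧ ω ∉ openConn o b ∧ ω ∉ openConn o c} with hE₁
  set E₃ : Set (BondConfig (Fin n)) := {ω | ω ∉ openConn o a ∧ ω ∈ openConn o b ∧ ω ∈ openConn o c} with hE₃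
  have hdisj : Disjoint E₃ (L ∩ (openConn o a : Set (BondConfig (Fin n)))ᶜ) := by
    rw [Set.disjoint_left]
    rintro ω ⟨_, hωb, hωc⟩ ⟨hωL, _⟩
    have := two_le_card_filter R o b c hb hc hbc ω hωb hωc
    have hle : (R.filter fun v => ω ∈ openConn o v).card ≤ 1 := hωL
    omega
  have hsubA : E₃ ∪ (L ∩ (openConn o a : Set (BondConfig (Fin n)))ᶜ) ⊆ (openConn o a : Set (BondConfig (Fin n)))ᶜ := by
    rintro ω (⟨hωa, _, _⟩ | ⟨_, hωa⟩)
    · exact hωa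
    · exact hωa
  calc μ.real L
      ≤ μ.real (E₁ ∪ (L ∩ (openConn o a : Set (BondConfig (Fin n)))ᶜ)) :=
        measureReal_mono (le_one_subset R o a b c ha hb hc hab hac)
    _ ≤ μ.real E₁ + μ.real (L ∩ (openConn o a : Set (BondConfig (Fin n)))ᶜ) := measureReal_union_le _ _
    _ ≤ μ.real E₃ + μ.real (L ∩ (openConn o a : Set (BondConfig (Fin n)))ᶜ) := by linarith
    _ = μ.real (E₃ ∪ (L ∩ (openConn o a : Set (BondConfig (Fin n)))ᶜ)) := (measureReal_union hdisj (hmeas _)).symm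
    _ ≤ μ.real (openConn o a : Set (BondConfig (Fin n)))ᶜ := measureReal_mono hsubA

/-- **(POCKET-½) ⇒ the two-finger bound at a relay observer.**  For `A.card = 5`, `o ∈ A`, `E N > 4` and `t` bounding the cuts
`μ(o ↮ b)`, `b ∈ A ∖ o`: `μ{#T_o ≤ 2} ≤ t`. [this work] -/
theorem twoFinger_at_observer_of_pocketHalf
    (hH : ∀ (n : ℕ) (w : Sym2 (Fin n) → unitInterval) (o a b c : Fin n),
      o ≠ a → o ≠ b → o ≠ c → a ≠ b → a ≠ c → b ≠ c →
      1 / 2 ≤ (prodBernoulli w).real (openConn o a) →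
      (prodBernoulli w).real (openConn o a) ≤ (prodBernoulli w).real (openConn o b) →
      (prodBernoulli w).real (openConn o a) ≤ (prodBernoulli w).real (openConn o c) →
      (prodBernoulli w).real {ω : BondConfig (Fin n) | ω ∈ openConn o a ∧ ω ∉ openConn o b ∧ ω ∉ openConn o c} ≤
        (prodBernoulli w).real {ω : BondConfig (Fin n) | ω ∉ openConn o a ∧ ω ∈ openConn o b ∧ ω ∈ openConn o c})
    (w : Sym2 (Fin n) → unitInterval) (A : Finset (Fin n)) (o : Fin n) (t : ℝ) (hA : A.card = 5) (ho : o ∈ A)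
    (hEN : 4 < ∑ x ∈ A, (prodBernoulli w).real (openConn o x))
    (hcut : ∀ b ∈ A, b ≠ o → (prodBernoulli w).real (openConn o b)ᶜ ≤ t) :
    (prodBernoulli w).real {ω : BondConfig (Fin n) | (A.filter fun x => ω ∈ openConn o x).card ≤ 2} ≤ t := by
  set μ := prodBernoulli w with hμ
  set q : Fin n → ℝ := fun x => μ.real (openConn o x) with hq
  have hq1 : ∀ x, q x ≤ 1 := fun x => measureReal_le_one
  -- the four other relays have `Σ q > 3`
  have hAo : (A.erase o).card = 4 := by rw [Finset.card_erase_of_mem ho, hA]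
  have hsumA : q o + ∑ x ∈ A.erase o, q x = ∑ x ∈ A, q x := Finset.add_sum_erase A q ho
  have hsum4 : 3 < ∑ x ∈ A.erase o, q x := by have := hq1 o; simp only [hq] at hsumA this ⊢; linarith
  -- drop the weakest of the four
  obtain ⟨v₀, hv₀, hmin₀⟩ := Finset.exists_min_image (A.erase o) q (Finset.card_pos.1 (by omega))
  set R := (A.erase o).erase v₀ with hRdef
  have hRcard : R.card = 3 := by rw [hRdef, Finset.card_erase_of_mem hv₀, hAo]
  have hRsubAo : R ⊆ A.erase o := Finset.erase_subset _ _
  have hRsub : R ⊆ A := hRsubAo.trans (Finset.erase_subset _ _)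
  have hoR : o ∉ R := fun h => (Finset.mem_erase.1 (hRsubAo h)).1 rfl
  have hsumR : q v₀ + ∑ x ∈ R, q x = ∑ x ∈ A.erase o, q x := Finset.add_sum_erase (A.erase o) q hv₀
  -- every remaining relay has `q ≥ ½`
  have hhalf : ∀ v ∈ R, 1 / 2 ≤ q v := by
    intro v hv
    by_contra hlt
    push Not at hlt
    have hv' : v ∈ A.erase o := hRsubAo hv
    have h0 : q v₀ ≤ q v := hmin₀ v hv'
    have hsumv : q v + ∑ x ∈ R.erase v, q x = ∑ x ∈ R, q x := Finset.add_sum_erase R q hv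
    have hcard2 : (R.erase v).card = 2 := by rw [Finset.card_erase_of_mem hv, hRcard]
    have hrest : ∑ x ∈ R.erase v, q x ≤ 2 := by
      calc ∑ x ∈ R.erase v, q x ≤ ∑ _x ∈ R.erase v, (1 : ℝ) := Finset.sum_le_sum fun x _ => hq1 x
        _ = 2 := by simp [hcard2]
    linarith
  -- the weakest of the remaining three, and the other two
  obtain ⟨a, ha, hmin⟩ := Finset.exists_min_image R q (Finset.card_pos.1 (by omega))
  obtain ⟨b, c, hb, hc, hab, hac, hbc, _⟩ := exists_pair_of_card_three_mem R a hRcard ha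
  have hoa : o ≠ a := fun h => hoR (h ▸ ha)
  have hob : o ≠ b := fun h => hoR (h ▸ hb)
  have hoc : o ≠ c := fun h => hoR (h ▸ hc)
  have hP := hH n w o a b c hoa hob hoc hab hac hbc (hhalf a ha) (hmin b hb) (hmin c hc)
  -- event inclusion, exchange, cut at `a`
  have hsub : {ω : BondConfig (Fin n) | (A.filter fun x => ω ∈ openConn o x).card ≤ 2} ⊆
      {ω : BondConfig (Fin n) | (R.filter fun v => ω ∈ openConn o v).card ≤ 1} :=
    fun ω hω => card_filter_le_one_of_le_two A R o ho hRsub hoR ω hω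
  calc μ.real {ω : BondConfig (Fin n) | (A.filter fun x => ω ∈ openConn o x).card ≤ 2}
      ≤ μ.real {ω : BondConfig (Fin n) | (R.filter fun v => ω ∈ openConn o v).card ≤ 1} := measureReal_mono hsub
    _ ≤ μ.real (openConn o a : Set (BondConfig (Fin n)))ᶜ :=
        measureReal_le_one_le_compl_of_exchange w R o a b c ha hb hc hab hac hbc hP
    _ ≤ t := hcut a (hRsub ha) hoa.symm

/-- **The glued half of oneCut(5) from (POCKET-½).**  If `o ∈ A`, `A.card = 5` and all relay–relay cuts are `≤ t`, then the
minority event has mass `≤ t` (case `E N ≤ 4` by the lonely-relay lemma, case `E N > 4` by the exchange). [this work] -/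
theorem oneCut5_at_of_mem_of_pocketHalf
    (hH : ∀ (n : ℕ) (w : Sym2 (Fin n) → unitInterval) (o a b c : Fin n),
      o ≠ a → o ≠ b → o ≠ c → a ≠ b → a ≠ c → b ≠ c →
      1 / 2 ≤ (prodBernoulli w).real (openConn o a) →
      (prodBernoulli w).real (openConn o a) ≤ (prodBernoulli w).real (openConn o b) →
      (prodBernoulli w).real (openConn o a) ≤ (prodBernoulli w).real (openConn o c) →
      (prodBernoulli w).real {ω : BondConfig (Fin n) | ω ∈ openConn o a ∧ ω ∉ openConn o b ∧ ω ∉ openConn o c} ≤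
        (prodBernoulli w).real {ω : BondConfig (Fin n) | ω ∉ openConn o a ∧ ω ∈ openConn o b ∧ ω ∈ openConn o c})
    (w : Sym2 (Fin n) → unitInterval) (A : Finset (Fin n)) (o : Fin n) (t : ℝ) (hA : A.card = 5) (ho : o ∈ A) (ht : 0 ≤ t)
    (hcut : ∀ a ∈ A, ∀ a' ∈ A, a ≠ a' → (prodBernoulli w).real (openConn a a')ᶜ ≤ t) :
    (prodBernoulli w).real {ω : BondConfig (Fin n) |
        1 ≤ (A.filter fun a => ω ∈ openConn o a).card ∧
        ((A.filter fun a => ω ∈ openConn o a).card : ℝ) <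
          (∑ a ∈ A, (prodBernoulli w).real (openConn o a)) / 2} ≤ t := by
  by_cases hEN : (∑ x ∈ A, (prodBernoulli w).real (openConn o x)) ≤ 4
  · exact oneCut_of_sum_le_four n w A o t hEN ht hcut
  · have hEN' : 4 < ∑ x ∈ A, (prodBernoulli w).real (openConn o x) := lt_of_not_ge hEN
    have hsub : {ω : BondConfig (Fin n) | 1 ≤ (A.filter fun a => ω ∈ openConn o a).card ∧
          ((A.filter fun a => ω ∈ openConn o a).card : ℝ) < (∑ a ∈ A, (prodBernoulli w).real (openConn o a)) / 2} ⊆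
        {ω : BondConfig (Fin n) | (A.filter fun x => ω ∈ openConn o x).card ≤ 2} :=
      fun ω hω => (minority_subset_le_two w A o hA hω).2
    exact (measureReal_mono hsub).trans
      (twoFinger_at_observer_of_pocketHalf hH w A o t hA ho hEN' fun b hb hbo => hcut o ho b hb hbo.symm)

end OneCutFive

end Summit.CriticalPhenomena.PercolationContinuityZ3.Theorems

end
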